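import Mathlib.NumberTheory.DirichletCharacter.Bounds
import Mathlib.Analysis.Complex.Basic
import HarnessLib

/-!
# rh-explicit (venture WeilGRH): «(5/·) HAS THE SECOND-HIGHEST LOWEST ZERO» — elementary glue: the trivial classes at the small conductors
  `5, 6, 7` and non-primitivity of the trivial character (weil-3 gen19)

Cell `rh-explicit`, WEIL TRACK (structure seat weil-3, gen19).  Pure Mathlib facts about Dirichlet characters of modulus `5`, `6`, `7`, used by
the runner-up assembly `RunnerUpGeneral` to dispose of the classes the one-prime rung `a = 12/25` does not certify below their threshold
conductor: a character mod `5` with `χ(2) = 1` is trivial (`2` generates `(ℤ/5)ˣ`); an even character mod `6` is trivial (the units are `±1`);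
an even character mod `7` with `χ(2) = 1` is trivial (`(ℤ/7)ˣ = ⟨3⟩`, `3² = 2`, `3³ = −1`); the trivial character of modulus `q > 1` is not
primitive; and an even primitive character mod `5` has `χ(2) = −1` (it is `(5/·)`).  RH/GRH-free; no definitions; standard axioms.
-/

set_option autoImplicit false

namespace Summit.Ventures.WeilGRH.Christoffel

/-- The non-zero residues mod `5`. -/
theorem zmod5_cases : ∀ x : ZMod 5, x ≠ 0 → x = 1 ∨ x = 2 ∨ x = 2 * 2 * 2 ∨ x = 2 * 2 := by decide

/-- **A character mod `5` with `χ(2) = 1` is trivial** (`2` generates the units mod `5`). -/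
theorem eq_one_of_chi_two_eq_one_mod5 (χ : DirichletCharacter ℂ 5) (h2 : χ (2 : ZMod 5) = 1) : χ = 1 := by
  haveI : Fact (1 < 5) := ⟨by norm_num⟩
  apply MulChar.ext'
  intro x
  by_cases hx : IsUnit x
  · rw [MulChar.one_apply hx]
    have hx0 : x ≠ 0 := hx.ne_zero
    rcases zmod5_cases x hx0 with rfl | rfl | rfl | rfl
    · exact map_one χ
    · exact h2
    · rw [map_mul, map_mul, h2]; norm_num
    · rw [map_mul, h2]; norm_num
  · rw [χ.map_nonunit hx, MulChar.map_nonunit _ hx]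

/-- The units mod `6` are `±1`. -/
theorem zmod6_unit_cases : ∀ x : ZMod 6, IsUnit x → x = 1 ∨ x = -1 := by decide

/-- **An even character mod `6` is trivial.** -/
theorem eq_one_of_even_mod6 (χ : DirichletCharacter ℂ 6) (heven : χ (-1) = 1) : χ = 1 := by
  apply MulChar.ext'
  intro x
  by_cases hx : IsUnit x
  · rw [MulChar.one_apply hx]
    rcases zmod6_unit_cases x hx with rfl | rfl
    · exact map_one χ
    · exact heven
  · rw [χ.map_nonunit hx, MulChar.map_nonunit _ hx]

/-- The non-zero residues mod `7` as words in `3` (`3² = 2`, `3³ = −1`). -/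
theorem zmod7_cases : ∀ x : ZMod 7, x ≠ 0 →
    x = 1 ∨ x = 2 ∨ x = 3 ∨ x = 2 * 2 ∨ x = -1 * 2 ∨ x = -1 := by decide

/-- **An even character mod `7` with `χ(2) = 1` is trivial** (`χ(3)² = χ(2) = 1` and `χ(3)³ = χ(−1) = 1` force `χ(3) = 1`). -/
theorem eq_one_of_even_of_chi_two_eq_one_mod7 (χ : DirichletCharacter ℂ 7) (heven : χ (-1) = 1) (h2 : χ (2 : ZMod 7) = 1) :
    χ = 1 := by
  haveI : Fact (1 < 7) := ⟨by norm_num⟩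
  have h3 : χ (3 : ZMod 7) = 1 := by
    have hsq : χ (3 : ZMod 7) ^ 2 = 1 := by rw [← map_pow, show ((3 : ZMod 7) ^ 2) = 2 by decide, h2]
    have hcb : χ (3 : ZMod 7) ^ 3 = 1 := by rw [← map_pow, show ((3 : ZMod 7) ^ 3) = -1 by decide, heven]
    have e : χ (3 : ZMod 7) = χ (3 : ZMod 7) ^ 3 * (χ (3 : ZMod 7) ^ 2)⁻¹ := by
      rw [hsq, inv_one, mul_one, hcb]
      have : χ (3 : ZMod 7) ^ 2 * χ (3 : ZMod 7) = χ (3 : ZMod 7) := by rw [hsq, one_mul]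
      rw [← this, ← pow_succ, hcb]
    rw [e, hcb, hsq]; norm_num
  apply MulChar.ext'
  intro x
  by_cases hx : IsUnit x
  · rw [MulChar.one_apply hx]
    rcases zmod7_cases x hx.ne_zero with rfl | rfl | rfl | rfl | rfl | rfl
    · exact map_one χ
    · exact h2
    · exact h3
    · rw [map_mul, h2, one_mul]
    · rw [map_mul, heven, h2, one_mul]
    · exact heven
  · rw [χ.map_nonunit hx, MulChar.map_nonunit _ hx]

/-- **The trivial character of modulus `q > 1` is not primitive** (its conductor is `1`). -/
theorem not_isPrimitive_one {q : ℕ} (hq : 1 < q) : ¬ (1 : DirichletCharacter ℂ q).IsPrimitive := by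
  haveI : NeZero q := ⟨by omega⟩
  intro h
  have hc : (1 : DirichletCharacter ℂ q).conductor = q := h
  rw [DirichletCharacter.conductor_one] at hc
  omega

/-- **An even primitive character mod `5` has `χ(2) = −1`** — it is the real character `(5/·)`: `χ(2) ∈ {±1, ±i}`, evenness `χ(−1) = χ(2)² = 1`
excludes `±i`, and `χ(2) = 1` would make `χ` trivial. -/
theorem chi_two_eq_neg_one_of_even_primitive_mod5 (χ : DirichletCharacter ℂ 5) (hprim : χ.IsPrimitive) (heven : χ (-1) = 1) :
    χ (2 : ZMod 5) = -1 := by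
  have hz : χ (2 : ZMod 5) ^ 4 = 1 := by rw [← map_pow, show ((2 : ZMod 5) ^ 4) = 1 by decide, map_one]
  have hneg : χ (-1) = χ (2 : ZMod 5) ^ 2 := by rw [← map_pow, show ((2 : ZMod 5) ^ 2) = -1 by decide]
  rw [hneg] at heven
  rcases sq_eq_one_iff.1 heven with h1 | h1
  · exact absurd hprim (by rw [eq_one_of_chi_two_eq_one_mod5 χ h1]; exact not_isPrimitive_one (by norm_num))
  · exact h1

end Summit.Ventures.WeilGRH.Christoffel
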